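import Summits.AtomisticToContinuum.BoseEinsteinCondensation.Theses.BECConjugateDomination
import HarnessLib

/-!
# `HardCoreExtension` in near-minimiser normal form
# (crux `BECConjugateDomination.HardCoreExtension`, stmt-AtomisticToContinuum-11786 — line `near-minimiser-slack-transfer`, lead c7)

The conjunct's quantity `condensateNumber v N L = ⨆_{δ>0} ⨅_{δ-near-minimisers Ψ} maxOccupation Ψ` is a NEAR-minimiser
infimum, so ground-state BEC at density `ρ` unfolds, with the fraction halved, to: one slack `δ = δ(N) > 0` below which
every Dirichlet near-minimiser has `λ_max(γ_Ψ) ≥ cN`, eventually in `N` (`hasGroundStateBEC_iff_nearMin`). Hence both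
sides of the crux `HardCoreExtension := A → B` are statements about near-minimisers with a per-`(v, N)` slack
(`antecedent_iff_nearMin`, `conjunct_iff_nearMin`, `hardCoreExtension_iff_nearMin`): `A` for the smooth class, `B` for
every admissible potential. The line's landed reduction (`hardCoreExtension_of_nearMinimiserTowerBEC`,
`…HardCoreExtensionNearMinTower.lean`) asks for the SAME kind of statement on the torus along the truncation tower of each
admissible `v` with the slack uniform in the level — the one feature `A` does not have. No exact minimiser, no simplicity
and no connectivity of hard-sphere configuration spaces is part of either side of the crux.

References: E. H. Lieb, R. Seiringer, J. P. Solovej, J. Yngvason, *The Mathematics of the Bose Gas and its Condensation*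
(2005), §1.2 (1.17)–(1.19), Ch. 5 p. 42.
-/

noncomputable section

namespace Summit.AtomisticToContinuum.BoseEinsteinCondensation.Cruxes.HardCoreExtension.NearMinTower

open MeasureTheory Filter
open scoped ENNReal NNReal Topology
open Literature.MathematicalPhysics.QuantumManyBody.BoseGas
open Summit.AtomisticToContinuum.BoseEinsteinCondensation.Theses.BECConjugateDomination

/-- **Ground-state BEC in near-minimiser form.** For `ρ > 0`: `HasGroundStateBEC v ρ` iff there is `c > 0` such that
for all large `N` ONE slack `δ > 0` makes every Dirichlet trial state in the box of side `(N/ρ)^{1/3}` with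
`energy ≤ E₀ + δ` have `λ_max(γ_Ψ) ≥ cN` (`→` with the fraction halved: unfold the `⨆ δ ⨅ Ψ`; `←` is `le_condensateNumber`).
[cite: LSSY2005, §1.2 (1.17)–(1.19)] -/
theorem hasGroundStateBEC_iff_nearMin (v : ℝ → ℝ≥0∞) (ρ : ℝ) :
    HasGroundStateBEC v ρ ↔
      ∃ c : ℝ, 0 < c ∧ ∀ᶠ N : ℕ in atTop, ∃ δ : ℝ≥0∞, 0 < δ ∧ ∀ Ψ : TrialState N (sideLength ρ N),
        energy v Ψ ≤ groundStateEnergy v N (sideLength ρ N) + δ →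
          ENNReal.ofReal (c * N) ≤ maxOccupation N Ψ.ψ := by
  constructor
  · rintro ⟨c, hc, h⟩
    refine ⟨c / 2, half_pos hc, ?_⟩
    filter_upwards [h, eventually_gt_atTop 0] with N hN hN0
    have hlt : ENNReal.ofReal (c / 2 * N) < condensateNumber v N (sideLength ρ N) := by
      refine lt_of_lt_of_le ?_ hN
      have hNpos : (0 : ℝ) < N := Nat.cast_pos.2 hN0
      exact (ENNReal.ofReal_lt_ofReal_iff (by positivity)).2 (by nlinarith)
    unfold condensateNumber at hlt
    rw [lt_iSup_iff] at hlt
    obtain ⟨δ, hδ⟩ := hlt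
    rw [lt_iSup_iff] at hδ
    obtain ⟨hδpos, hlt'⟩ := hδ
    exact ⟨δ, hδpos, fun Ψ hΨ => hlt'.le.trans (iInf₂_le Ψ hΨ)⟩
  · rintro ⟨c, hc, h⟩
    refine ⟨c, hc, ?_⟩
    filter_upwards [h] with N hN
    obtain ⟨δ, hδ, hΨ⟩ := hN
    exact le_condensateNumber v hδ hΨ

/-- **The antecedent `A` of the crux in near-minimiser form**: dilute Dirichlet near-minimiser BEC for every smooth-class
potential, the slack depending on the potential and on `N`. [cite: LSSY2005, §1.2 (1.19)] -/
theorem antecedent_iff_nearMin :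
    (∀ v : ℝ → ℝ≥0∞, IsRepulsiveFiniteRange v → (∀ r, v r ≠ ⊤) →
      ContDiff ℝ 2 (fun x : Space => (v ‖x‖).toReal) →
      (∃ Cₑ : ℝ, ∀ x : Space,
        ‖iteratedFDeriv ℝ 2 (fun x : Space => (v ‖x‖).toReal) x‖ ≤ Cₑ * Real.sqrt ((v ‖x‖).toReal)) →
      ∃ ρ₀ : ℝ, 0 < ρ₀ ∧ ∀ ρ : ℝ, 0 < ρ → ρ < ρ₀ → HasGroundStateBEC v ρ) ↔
    (∀ v : ℝ → ℝ≥0∞, IsRepulsiveFiniteRange v → (∀ r, v r ≠ ⊤) →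
      ContDiff ℝ 2 (fun x : Space => (v ‖x‖).toReal) →
      (∃ Cₑ : ℝ, ∀ x : Space,
        ‖iteratedFDeriv ℝ 2 (fun x : Space => (v ‖x‖).toReal) x‖ ≤ Cₑ * Real.sqrt ((v ‖x‖).toReal)) →
      ∃ ρ₀ : ℝ, 0 < ρ₀ ∧ ∀ ρ : ℝ, 0 < ρ → ρ < ρ₀ →
        ∃ c : ℝ, 0 < c ∧ ∀ᶠ N : ℕ in atTop, ∃ δ : ℝ≥0∞, 0 < δ ∧ ∀ Ψ : TrialState N (sideLength ρ N),
          energy v Ψ ≤ groundStateEnergy v N (sideLength ρ N) + δ →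
            ENNReal.ofReal (c * N) ≤ maxOccupation N Ψ.ψ) := by
  refine forall₅_congr fun v _ _ _ _ => ?_
  refine exists_congr fun ρ₀ => and_congr_right fun _ => forall₃_congr fun ρ _ _ => ?_
  exact hasGroundStateBEC_iff_nearMin v ρ

/-- **The conjunct `B` in near-minimiser form**: dilute Dirichlet near-minimiser BEC for EVERY repulsive finite-range
potential (hard cores, shells, kinks included), the slack depending on the potential and on `N`.
[cite: LSSY2005, §1.2 (1.19) and Ch. 5 p. 42] -/
theorem conjunct_iff_nearMin :
    Literature.MathematicalPhysics.QuantumManyBody.BoseGas.BoseEinsteinCondensation ↔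
    (∀ v : ℝ → ℝ≥0∞, IsRepulsiveFiniteRange v →
      ∃ ρ₀ : ℝ, 0 < ρ₀ ∧ ∀ ρ : ℝ, 0 < ρ → ρ < ρ₀ →
        ∃ c : ℝ, 0 < c ∧ ∀ᶠ N : ℕ in atTop, ∃ δ : ℝ≥0∞, 0 < δ ∧ ∀ Ψ : TrialState N (sideLength ρ N),
          energy v Ψ ≤ groundStateEnergy v N (sideLength ρ N) + δ →
            ENNReal.ofReal (c * N) ≤ maxOccupation N Ψ.ψ) := by
  refine forall₂_congr fun v _ => ?_
  refine exists_congr fun ρ₀ => and_congr_right fun _ => forall₃_congr fun ρ _ _ => ?_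
  exact hasGroundStateBEC_iff_nearMin v ρ

/-- **`HardCoreExtension` in near-minimiser normal form**: per-potential Dirichlet near-minimiser BEC on the smooth class
implies the same on the whole admissible class. Both sides quantify over NEAR-minimisers with a slack `δ(v, N)`; neither
mentions exact minimisers, simplicity of ground states or connectivity of hard-sphere configuration spaces.
[cite: LSSY2005, §1.2 (1.19) and Ch. 5 p. 42] -/
theorem hardCoreExtension_iff_nearMin :
    HardCoreExtension ↔
    ((∀ v : ℝ → ℝ≥0∞, IsRepulsiveFiniteRange v → (∀ r, v r ≠ ⊤) →
      ContDiff ℝ 2 (fun x : Space => (v ‖x‖).toReal) →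
      (∃ Cₑ : ℝ, ∀ x : Space,
        ‖iteratedFDeriv ℝ 2 (fun x : Space => (v ‖x‖).toReal) x‖ ≤ Cₑ * Real.sqrt ((v ‖x‖).toReal)) →
      ∃ ρ₀ : ℝ, 0 < ρ₀ ∧ ∀ ρ : ℝ, 0 < ρ → ρ < ρ₀ →
        ∃ c : ℝ, 0 < c ∧ ∀ᶠ N : ℕ in atTop, ∃ δ : ℝ≥0∞, 0 < δ ∧ ∀ Ψ : TrialState N (sideLength ρ N),
          energy v Ψ ≤ groundStateEnergy v N (sideLength ρ N) + δ →
            ENNReal.ofReal (c * N) ≤ maxOccupation N Ψ.ψ) →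
    (∀ v : ℝ → ℝ≥0∞, IsRepulsiveFiniteRange v →
      ∃ ρ₀ : ℝ, 0 < ρ₀ ∧ ∀ ρ : ℝ, 0 < ρ → ρ < ρ₀ →
        ∃ c : ℝ, 0 < c ∧ ∀ᶠ N : ℕ in atTop, ∃ δ : ℝ≥0∞, 0 < δ ∧ ∀ Ψ : TrialState N (sideLength ρ N),
          energy v Ψ ≤ groundStateEnergy v N (sideLength ρ N) + δ →
            ENNReal.ofReal (c * N) ≤ maxOccupation N Ψ.ψ)) := by
  unfold HardCoreExtension
  rw [antecedent_iff_nearMin, conjunct_iff_nearMin]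

end Summit.AtomisticToContinuum.BoseEinsteinCondensation.Cruxes.HardCoreExtension.NearMinTower

end
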